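/-
Copyright (c) 2026 the pub-hodgecm-mathlib formalisation cell (harness21).  Prover seat hodgecm-mathlib-F0P3a-p04 (g33); E1 keeper ∕ dealer F0P3a-p03 (g31) k69
2026-09-03T05:59:30Z, E1 BRICK LEDGER row 46‴ «K4′ SENTENCE WITH THE WIDENED `hJ`» (sibling of ★ row 46″ `F0P3cStCharTSK4PrimeSelfExtSplitSentence`, F0P2-p02 (g26)).
-/
import Summits.HodgeConjecture.HodgeConjecture.Theorems.F0P3cStCharTSK4PrimeSelfExtSplit          -- ★ row 46 D′46 (F0P2-p02 (g26)) p853349: `exists_section_selfExtension_of_jacquet_alternative_of_jet_intertwiner` (brings ★ G3, ★ D: (D1), ★ G2, ★ FN, ★ J1∕J2)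
import Summits.HodgeConjecture.HodgeConjecture.Theorems.F0P3cStCharTSK2PiTwoSelfExtSplitSentence -- ★ row 40″ (F0P3b-p01 (g25)): `exists_representation_unipotentModel_jet` (the unipotent model in the JET letters)
import Literature.RepresentationTheory.CharacterSelfExtensionJacquetAlternativeSub               -- ★ row 46′ (F0P2-p02 (g26)) p853350: `jacquetAlternative_of_selfExtension_char_sub` (brings ★ 40′: `finiteDimensional_selfExtension`)
import HarnessLib

/-!
# K4′ — THE SENTENCE WITH THE WIDENED JET HYPOTHESIS: a smooth self-extension of `π⁺ ⊂ i_P(χ₁)` SPLITS, given the self-extension structure of its Jacquet module over the `χ`-line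
# (with `r_P(ι)(r_P π⁺)` the sub line), a height for every occurring non-zero additive character, and a jet intertwiner `(𝒜₀, 𝒜₁)` for the height jet of each such ADDITIVE character
# along each RIGHT-SMOOTH height

Cell `pub/hodgecm-mathlib`, crux H413 = `stmt-HodgeConjecture-24833` (`--supports` lane, helper, THEOREMS ONLY: no definition ∕ instance ∕ notation ∕ named fact ∕ `sorry`).
Namespace `Summit.HodgeConjecture.HodgeConjecture.Cruxes.H413.F0P3cStCharTSK4PrimeSelfExtSplitSentenceWide`.  E1 BRICK LEDGER (F0P3a-p03 (g31), k61∕k69) row 46‴ — the SIBLING of ★ row 46″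
`F0P3cStCharTSK4PrimeSelfExtSplitSentence.selfExtension_splits_of_jacquet_selfExtension_of_jet_intertwiner` (F0P2-p02 (g26)) with the SAME letters, the SAME conclusion and the SAME proof,
and exactly ONE binder changed: the jet hypothesis `hJ` ((J∀occ) «a jet intertwiner `(𝒜₀, 𝒜₁)` exists for the height jet of every non-zero additive character OCCURRING in `r_P τ`») now
carries the FIVE further antecedents `hlam1 : lam 1 = 0`, `hlam : ∀ m m′, lam (m * m′) = lam m + lam m′` (the character is ADDITIVE) and `KΛ`, `hKΛ : IsOpen KΛ`,
`hΛK : ∀ x κ, κ ∈ KΛ → Λ (x * κ) = Λ x` (the height is RIGHT-SMOOTH) — precisely the letters that ★ 46′ `jacquetAlternative_of_selfExtension_char_sub` and the height oracle `hH` DELIVER at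
the one place where `hJ` is invoked, so the hypothesis is WEAKER and the sentence STRONGER, at zero cost.  Purpose: the consumer (E1 row 68-H, the K4′ split at the CM datum) discharges the
widened `hJ` by ONE lambda over ★ (O1) `F0P3cStCharTSK4PrimeJetIntertwiner.exists_jetIntertwiner_of_openCellJet` (F0P2-p02 (g27)), whose unipotent model ★ 40″ §0
`exists_representation_unipotentModel_jet` needs `hlam1 hlam` and whose (GL-jet)∕(E4) rigidity needs the open fixer `KΛ` of the height.  §0 adds the five-line generic bridge
`involution_ne_smul_one` (`𝒜₀² = 1`, `𝒜₀ ≠ ±1` ⇒ `𝒜₀ ∉ k·1`) feeding (O1)'s letter `hA₀ns` from ★ `Literature.RepresentationTheory.InvolutionOfTwoConstituents`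
(`involution_ne_one`, `involution_ne_neg_one`, E1 row 68-B).  Seat F0P3a-p04 (g33).

THE MATHEMATICS (letters of ★ 40″ ∕ ★ 46″ VERBATIM).  `t` a parabolic triple of a topological group `G` with `δ_P|_N = 1` (`hδ`), `χ : ↥t.M →* ℂ` unit-valued with its line `χ₁` (`hχ₁`),
`I₀ := normalizedInd t χ₁` on `V := SmoothInd t.P (χ₁ ∘ proj ⊗ δ^{1/2})`, `τ` SMOOTH on `X`, `0 → A —ι→ τ —p→ A → 0` a self-extension of an invariant irreducible `A ≤ I₀` with
`Hom_G(A, I₀ ∕ A) = 0` and Schur ((a), (d1′) PRINT); (J-data) `𝒜₀ ∈ End_G(I₀)` with `𝒜₀ = 1` on `A` (`hA₀`, `hAfix`); (b) `r_P τ := τ.normalizedJacquet t` IS A SELF-EXTENSION OF THE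
`χ`-LINE in ★ CHAR-EXT ∕ 40′ letters (`pJ`, `hquot`, `hker`, `u₀`, `e`, `hu₀`, `he`, `hline`, `hfree`) AND its sub line `ker pJ = ℂ·e` is the image of `r_P A` (`hιker : pJ [ι a] = 0`,
`hιe : ∃ a, [ι a] = e` — input class: `r_B` exact ★ + «`r_B π⁺` is the `θ̃`-line» PRINT); (H) the HEIGHT ORACLE of ★ 40″ v2 (occurrence antecedent); (J∀occ) as above, WIDENED: for
every ADDITIVE non-zero `λ` (`λ 1 = 0`, `λ(mm′) = λ m + λ m′`) occurring in `r_P τ`, every RIGHT-SMOOTH height `Λ` of `λ` (open fixer `KΛ`) and every height jet `π₁` of `I₀` along `Λ`, a jet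
intertwiner `𝒜₁` exists.  THEN **`p` HAS AN EQUIVARIANT SECTION — `τ` SPLITS** (`selfExtension_splits_of_jacquet_selfExtension_of_jet_intertwiner`).  Proof (★ 46″'s, verbatim but for the
one call of `hJ`): the alternative ★ 46′ `jacquetAlternative_of_selfExtension_char_sub` on `r_P τ`; SPLIT branch → ★ D (D1) + ★ G2 `exists_section_of_two_le_finrank` (no jet); NON-SPLIT
branch → `λ ≠ 0` ADDITIVE occurring, the model `N₀` (★ 40″ §0), `θ : r_P τ → N₀` missing the sub, carrying `ker pJ` into the sub and with `θ e ≠ 0`, a RIGHT-SMOOTH height `Λ` ((H)), ★ J2's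
jet package `(π₁, ρ)`, `𝒜₁` ((J∀occ), now fed `hlam1 hlam KΛ hKΛ hΛK` as well), and ★ D′46 `exists_section_selfExtension_of_jacquet_alternative_of_jet_intertwiner` (over ★ G3's Hom-count +
★ D (F)).  At the CM datum (`t := cmBorelTriple L 3 v`, `χ = θ̃`, `A = π⁺`): every smooth self-extension of `π⁺` splits — the K4′ cell of the residue matrix, Ext-free; with the widened
`hJ` the (J∀occ) input is the shape ★ (O1) proves from (GL-jet) + `hss` + `hrank` + `hEnd` + `hA₀sq` + `hA₀ns` (§0 below supplies `hA₀ns` from `𝒜₀² = 1`, `𝒜₀ ≠ ±1`).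
[cite: Keys1984, §3 pp. 118–119; §4 Thm. 3 p. 120] [cite: Rogawski1990, §12.2 p. 173] [cite: Casselman1995, §6.3] [cite: BernsteinZelevinsky1977, §2.3]
HONEST LABEL: count-neutral datum assembly (a re-statement of ★ 46″ with one hypothesis weakened to the ★-supplied letters); (d1′)∕(b)∕sub-line∕(H) are PRINT-class named hypotheses and
(J∀occ) stays a BINDER of the sentence, discharged only by its consumer; h413 OPEN; HC_CM is proved only modulo the 7 printed citations (2 remaining named inputs hLiu418 =
stmt-HodgeConjecture-24832, h413 = stmt-HodgeConjecture-24833) until rung 0 closes.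

## References
* [Keys1984] D. Keys, *Principal series representations of special unitary groups over local fields*, Compositio Math. 51 (1984), §3 pp. 118–119, §4 Thm. 3 p. 120.
* [Rogawski1990] J. D. Rogawski, *Automorphic Representations of Unitary Groups in Three Variables*, Ann. of Math. Stud. 123 (1990), §12.2 p. 173.
* [Casselman1995] W. Casselman, *Introduction to the theory of admissible representations of p-adic reductive groups* (1995), §6.3.
* [BernsteinZelevinsky1977] I. N. Bernstein, A. V. Zelevinsky, *Induced representations of reductive p-adic groups I*, Ann. Sci. ÉNS 10 (1977), §2.3.
-/

set_option autoImplicit false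

set_option linter.dupNamespace false

noncomputable section

open NumberField IsDedekindDomain

namespace Summit.HodgeConjecture.HodgeConjecture.Cruxes.H413.F0P3cStCharTSK4PrimeSelfExtSplitSentenceWide

open Literature.NumberTheory.Automorphic Literature.NumberTheory.Automorphic.UnitaryGroup Representation Literature.RepresentationTheory
open Summit.HodgeConjecture.HodgeConjecture.Cruxes.H413
open Summit.HodgeConjecture.HodgeConjecture.Cruxes.H413.F0P3cStCharTSK2PiTwoSelfExtSplit
open Summit.HodgeConjecture.HodgeConjecture.Cruxes.H413.F0P3cStCharTSK2PiTwoSelfExtSplitSentence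
open Summit.HodgeConjecture.HodgeConjecture.Cruxes.H413.F0P3cStCharTSK4PrimeSelfExtSplit

/-! ## §0 The bridge `𝒜₀² = 1`, `𝒜₀ ≠ ±1` ⇒ `𝒜₀` is not a scalar (feeds ★ (O1)'s letter `hA₀ns` from ★ `InvolutionOfTwoConstituents`) -/

section Bridge

/-- **An involution other than `±1` is not a scalar.**  For an endomorphism `𝒜₀` of a `k`-vector space with `𝒜₀² = 1`, `𝒜₀ ≠ 1` and `𝒜₀ ≠ −1`: `𝒜₀ ≠ c·1` for every `c : k` — if
`𝒜₀ = c·1` then `c² = 1` forces `c = ±1`, and `c² ≠ 1` forces `(c² − 1)·1 = 0`, i.e. `1 = 0`, i.e. `𝒜₀ = 1`.  At the CM datum `𝒜₀ = P_{π_s} − P_{π_n}` (★ E1 row 68-B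
`Literature.RepresentationTheory.exists_involution_of_isCompl`, `involution_ne_one`, `involution_ne_neg_one`) this is the letter `hA₀ns : ∀ c, 𝒜₀ ≠ c • 1` of ★ (O1)
`F0P3cStCharTSK4PrimeJetIntertwiner.exists_jetIntertwiner_of_openCellJet`. [cite: Keys1984, §4 Thm. 3 p. 120] -/
theorem involution_ne_smul_one {k : Type*} [Field k] {V : Type*} [AddCommGroup V] [Module k V] {A₀ : Module.End k V}
    (hsq : A₀ * A₀ = 1) (h1 : A₀ ≠ 1) (hm1 : A₀ ≠ -1) (c : k) : A₀ ≠ c • 1 := by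
  intro hc
  have hcc : (c * c) • (1 : Module.End k V) = 1 := by
    calc (c * c) • (1 : Module.End k V) = (c • (1 : Module.End k V)) * (c • 1) := by rw [smul_mul_assoc, one_mul, mul_smul]
      _ = 1 := by rw [← hc, hsq]
  by_cases hc1 : c * c = 1
  · rcases mul_self_eq_one_iff.mp hc1 with rfl | rfl
    · exact h1 (by rw [hc, one_smul])
    · exact hm1 (by rw [hc, neg_one_smul])
  · have h10 : (1 : Module.End k V) = 0 := by
      have h0 : (c * c - 1) • (1 : Module.End k V) = 0 := by rw [sub_smul, one_smul, hcc, sub_self]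
      rw [← inv_smul_smul₀ (sub_ne_zero.mpr hc1) (1 : Module.End k V), h0, smul_zero]
    exact h1 (by rw [hc, h10, smul_zero])

end Bridge

/-! ## §1 Any parabolic triple `t` with `δ_P|_N = 1`, `σ₀ := χ₁` a line -/

section AnyTriple

variable {G : Type*} [Group G] [TopologicalSpace G] [IsTopologicalGroup G] (t : ParabolicTriple G) [LocallyCompactSpace ↥t.P]
  (hδ : ∀ (n : G) (hn : n ∈ t.N), deltaChar t.P ⟨n, t.N_le hn⟩ = 1)
  (χ : ↥t.M →* ℂ) (χ₁ : Representation ℂ ↥t.M ℂ) (hχ₁ : ∀ (m : ↥t.M) (x : ℂ), χ₁ m x = χ m * x)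
  {X : Type*} [AddCommGroup X] [Module ℂ X] (τ : Representation ℂ G X) (hτ : τ.IsSmooth)

include hδ hχ₁ hτ in
/-- **K4′ — THE SENTENCE (widened jet hypothesis).**  A SMOOTH self-extension `0 → A —ι→ τ —p→ A → 0` of an invariant irreducible `A ≤ I₀ = i_P(χ₁)` with `Hom_G(A, I₀ ∕ A) = 0`, Schur
and `𝒜₀ = 1` on `A` for a `G`-endomorphism `𝒜₀` of `I₀` SPLITS, given: (b) the self-extension structure of its Jacquet module `r_P τ` over the `χ`-line (★ CHAR-EXT letters `pJ u₀ e`)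
with `ker pJ` the image of `r_P A` (`hιker`, `hιe`), (H) a right-smooth height for every non-zero additive character occurring in `r_P τ`, and (J∀occ) a jet intertwiner `(𝒜₀, 𝒜₁)` for the
height jet of every non-zero ADDITIVE character occurring in `r_P τ` along every RIGHT-SMOOTH height (★ 46″'s `hJ` with the five further antecedents `hlam1 hlam KΛ hKΛ hΛK`, exactly the
letters ★ 46′ and `hH` deliver where `hJ` is used — a weaker hypothesis, the same proof).  At the CM datum (`t := cmBorelTriple L 3 v`, `A = π⁺`, `χ = θ̃`): every smooth self-extension of
`π⁺` splits — the K4′ cell of the residue matrix, Ext-free, modulo the NAMED printed inputs; the widened `hJ` is the shape ★ (O1) `exists_jetIntertwiner_of_openCellJet` discharges.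
[cite: Keys1984, §3 pp. 118–119; §4 Thm. 3 p. 120] [cite: Rogawski1990, §12.2 p. 173] [cite: Casselman1995, §6.3] [cite: BernsteinZelevinsky1977, §2.3] -/
theorem selfExtension_splits_of_jacquet_selfExtension_of_jet_intertwiner (hχ : ∀ m, IsUnit (χ m))
    -- (a) the self-extension of `A ≤ I₀` (★ G2 letters; (d1′) PRINT)
    (A : Submodule ℂ (SmoothInd t.P (Representation.twist (χ₁.comp t.proj) (rootDeltaChar t.P))))
    (hAinv : ∀ g, A ≤ A.comap (Representation.normalizedInd t χ₁ g))
    (hAirr : ∀ B : Submodule ℂ (SmoothInd t.P (Representation.twist (χ₁.comp t.proj) (rootDeltaChar t.P))), B ≤ A →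
      (∀ g, B ≤ B.comap (Representation.normalizedInd t χ₁ g)) → B = ⊥ ∨ B = A)
    (hHom0 : ∀ ψ : IntertwiningMap ((Representation.normalizedInd t χ₁).subrepresentation A hAinv) ((Representation.normalizedInd t χ₁).quotient A hAinv), ψ = 0)
    (hSchur : Module.finrank ℂ (IntertwiningMap ((Representation.normalizedInd t χ₁).subrepresentation A hAinv)
      ((Representation.normalizedInd t χ₁).subrepresentation A hAinv)) = 1)
    -- (J-data) the fixed involution `𝒜₀ ∈ End_G(I₀)` with `𝒜₀ = 1` on `A = π⁺` (PRINT [Keys1984 §4 Thm. 3])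
    (A₀ : Module.End ℂ (SmoothInd t.P (Representation.twist (χ₁.comp t.proj) (rootDeltaChar t.P))))
    (hA₀ : ∀ g, A₀ * Representation.normalizedInd t χ₁ g = Representation.normalizedInd t χ₁ g * A₀) (hAfix : ∀ a ∈ A, A₀ a = a)
    (ι : IntertwiningMap ((Representation.normalizedInd t χ₁).subrepresentation A hAinv) τ)
    (p : IntertwiningMap τ ((Representation.normalizedInd t χ₁).subrepresentation A hAinv))
    (hp : Function.Surjective p) (hexact : LinearMap.ker p.toLinearMap = LinearMap.range ι.toLinearMap)
    -- (b) «`r_P τ` is a self-extension of the `χ`-line» (★ CHAR-EXT ∕ 40′ letters; PRINT input class) …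
    (pJ : (t.restrict τ).Coinvariants →ₗ[ℂ] ℂ) (hquot : ∀ (m : ↥t.M) (u : (t.restrict τ).Coinvariants), pJ (τ.normalizedJacquet t m u) = χ m * pJ u)
    (hker : ∀ (m : ↥t.M) (u : (t.restrict τ).Coinvariants), pJ u = 0 → τ.normalizedJacquet t m u = χ m • u)
    {u₀ e : (t.restrict τ).Coinvariants} (hu₀ : pJ u₀ = 1) (he : pJ e = 0)
    (hline : ∀ w : (t.restrict τ).Coinvariants, pJ w = 0 → ∃ c : ℂ, w = c • e) (hfree : ∀ c : ℂ, c • e = 0 → c = 0)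
    -- … WITH `ker pJ = r_P(ι)(r_P A)` (the K4′ sub-line input; input class)
    (hιker : ∀ a : A, pJ (Coinvariants.mk (t.restrict τ) (ι a)) = 0) (hιe : ∃ a : A, Coinvariants.mk (t.restrict τ) (ι a) = e)
    -- (H) HEIGHT ORACLE for the non-zero additive characters OCCURRING in `r_P τ` (★ 40″ v2's letters VERBATIM)
    (hH : ∀ lam : ↥t.M → ℂ, lam 1 = 0 → (∀ m m' : ↥t.M, lam (m * m') = lam m + lam m') → (∃ m, lam m ≠ 0) →
      (∀ m : ↥t.M, τ.normalizedJacquet t m u₀ - χ m • u₀ = (χ m * lam m) • e) →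
      ∃ (Λ : G → ℂ) (KΛ : Subgroup G), IsOpen (KΛ : Set G) ∧ (∀ (x κ : G), κ ∈ KΛ → Λ (x * κ) = Λ x) ∧
        ∀ (q : ↥t.P) (g : G), Λ ((q : G) * g) = lam (t.proj q) + Λ g)
    -- (J∀occ) WIDENED: a jet intertwiner `(𝒜₀, 𝒜₁)` for the height jet of every non-zero ADDITIVE character OCCURRING in `r_P τ` along every RIGHT-SMOOTH height
    -- (★ 46″'s binder with `hlam1 hlam` after `lam` and `KΛ hKΛ hΛK` after `Λ`; the shape ★ (O1) `exists_jetIntertwiner_of_openCellJet` discharges) [Keys1984 §3–§4]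
    (hJ : ∀ (lam : ↥t.M → ℂ), lam 1 = 0 → (∀ m m' : ↥t.M, lam (m * m') = lam m + lam m') → (∃ m, lam m ≠ 0) →
      (∀ m : ↥t.M, τ.normalizedJacquet t m u₀ - χ m • u₀ = (χ m * lam m) • e) →
      ∀ (Λ : G → ℂ) (KΛ : Subgroup G), IsOpen (KΛ : Set G) → (∀ (x κ : G), κ ∈ KΛ → Λ (x * κ) = Λ x) →
        (∀ (q : ↥t.P) (g : G), Λ ((q : G) * g) = lam (t.proj q) + Λ g) →
      ∀ (π₁ : G → Module.End ℂ (SmoothInd t.P (Representation.twist (χ₁.comp t.proj) (rootDeltaChar t.P)))),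
        (∀ (g : G) (w : SmoothInd t.P (Representation.twist (χ₁.comp t.proj) (rootDeltaChar t.P))) (x : G), (π₁ g w).toFun x = (Λ (x * g) - Λ x) • w.toFun (x * g)) →
          ∃ A₁ : Module.End ℂ (SmoothInd t.P (Representation.twist (χ₁.comp t.proj) (rootDeltaChar t.P))),
            ∀ g, A₁ * Representation.normalizedInd t χ₁ g - Representation.normalizedInd t χ₁ g * A₁ = -(π₁ g * A₀ + A₀ * π₁ g)) :
    ∃ s : IntertwiningMap ((Representation.normalizedInd t χ₁).subrepresentation A hAinv) τ,
      p.comp s = IntertwiningMap.id ((Representation.normalizedInd t χ₁).subrepresentation A hAinv) := by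
  -- the Jacquet alternative WITH its sub line (★ 46′) on the self-extension `r_P τ` of the `χ`-line
  rcases jacquetAlternative_of_selfExtension_char_sub (τ.normalizedJacquet t) χ hχ pJ hquot hker hu₀ he hline hfree χ₁ hχ₁ with
    h2 | ⟨lam, hlam1, hlam, hne, hocc, hθ⟩
  · -- SPLIT branch: `2 ≤ dim Hom_M(r_P τ, χ₁) ⇒ 2 ≤ dim Hom_G(τ, I₀)` (★ D (D1)) ⇒ section by Hom-count (★ G2), no jet, no (J)
    exact exists_section_of_two_le_finrank (Representation.normalizedInd t χ₁) A hAinv hAirr hHom0 hSchur τ ι p hp hexact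
      (two_le_finrank_intertwiningMap_normalizedInd_of_jacquet t hδ χ₁ τ hτ h2)
  · -- NON-SPLIT branch: the unipotent model in the JET letters (★ 40″ §0), `θ` with its sub-line clauses, a height, ★ J2's jet package, `𝒜₁`, ★ D′46's assembly
    obtain ⟨N₀, hN₀⟩ := exists_representation_unipotentModel_jet χ lam hlam1 hlam
    obtain ⟨θ, ⟨y, hy⟩, hsub, hθe⟩ := hθ N₀ hN₀
    obtain ⟨Λ, KΛ, hKΛ, hΛK, hΛ⟩ := hH lam hlam1 hlam hne hocc
    have hN₀' : ∀ (m : ↥t.M) (w : ℂ × ℂ), N₀ m w = (χ₁ m w.1, lam m • χ₁ m w.1 + χ₁ m w.2) := fun m w => by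
      rw [hN₀, hχ₁, hχ₁, smul_eq_mul]
    obtain ⟨Ψ, π₁, ρ, -, hπ₁, -, -, hρ, -⟩ :=
      F0P3cStCharTSJetAtDatum.exists_linearEquiv_normalizedInd_unipotentModel_jet t χ₁ lam N₀ hN₀' Λ hΛ KΛ hKΛ hΛK
    obtain ⟨A₁, hA₁⟩ := hJ lam hlam1 hlam hne hocc Λ KΛ hKΛ hΛK hΛ π₁ hπ₁
    -- `r_P τ` is finite-dimensional (★ 40′), so ★ D′46's `[FiniteDimensional]` binders are instances
    haveI : FiniteDimensional ℂ (t.restrict τ).Coinvariants :=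
      finiteDimensional_selfExtension (τ.normalizedJacquet t) χ hχ pJ hquot hker hu₀ he hline hfree
    obtain ⟨a₀, ha₀⟩ := hιe
    exact exists_section_selfExtension_of_jacquet_alternative_of_jet_intertwiner t hδ χ₁ τ lam N₀ hN₀' Λ hΛ KΛ hKΛ hΛK π₁ hπ₁ ρ hρ hτ
      A₀ A₁ hA₀ hA₁ A hAfix hAinv hAirr hHom0 hSchur ι p hp hexact
      (Or.inr ⟨θ, ⟨y, hy⟩, fun a => hsub _ (hιker a), ⟨a₀, by rw [ha₀]; exact hθe⟩⟩)

end AnyTriple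

end Summit.HodgeConjecture.HodgeConjecture.Cruxes.H413.F0P3cStCharTSK4PrimeSelfExtSplitSentenceWide

end
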